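import Literature.MathematicalPhysics.QuantumManyBody.PeriodicBoseGas
import Mathlib.Analysis.SpecialFunctions.Gamma.Basic
import Mathlib.Analysis.SpecialFunctions.Pow.Real
import Mathlib.MeasureTheory.Measure.WithDensity
import HarnessLib

/-!
# The neutralised periodic (jellium-type) super-Coulombic Riesz gas in a box

Topic `MathematicalPhysics/StatisticalMechanics`; definition item `defn-NeutralizedRieszGas` (route
AtomisticToContinuum/BECRieszLandscape, crux `RieszLandscapeLocalLaw` `stmt-AtomisticToContinuum-7045`),
companion of the periodic Bose-gas vocabulary `Literature.MathematicalPhysics.QuantumManyBody.BoseGas`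
(`Space = ℝ³`, `Config N`, `cell L = [0, L)³`, `cellN N L`, `latticeVec L n = L n ∈ Lℤ³`;
`PeriodicBoseGas.lean`), whose lattice periodisation `periodizedPotential` (an `ℝ≥0∞` sum over
`Lℤ³`) is `+∞` for the long-range profiles `r⁻ˢ`, `s < 3`: the Riesz interaction must be
periodised TOGETHER with a uniform neutralising background (Lewin 2022, §4: "the `Λ`-periodic
potential `V_s^Λ` which has the same Fourier coefficients as `V_s` and satisfies `∫_Q V_s^Λ = 0`",
`V_s(x) = |x|⁻ˢ` for `0 < s < d`, obtained as the limit of lattice sums minus background, loc. cit.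
Lemma 31; the Riesz gas with exponent `d - 2 < s < d`, `g(x) = |x|⁻ˢ/s`,
`H_N = ½ ∑_{i ≠ j} g(xᵢ - xⱼ) + …`, `h_N = g ∗ (∑ δ_{xᵢ} - N μ)` is Peilen–Serfaty 2025, (1.1)–(1.3)
and (3.3)). Dimension `d = 3` throughout.

## Definitions (real-valued; all over `Space = EuclideanSpace ℝ (Fin 3)`)

* `rieszTheta L r₀ t x = ∑_{n ∈ ℤ³} exp(-t · max(‖x - L n‖, r₀)²)` — the lattice Gaussian sum
  (theta function) of the heat-kernel representation `r⁻ˢ = Γ(s/2)⁻¹ ∫₀^∞ t^{s/2-1} e^{-t r²} dt`,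
  with the distances capped below at the UV-regularisation length `r₀ ≥ 0` (`r₀ = 0`: no cap).
* `neutralizedRieszKernel s L r₀ x = (s Γ(s/2))⁻¹ ∫₀^∞ t^{s/2-1} (rieszTheta L r₀ t x - (π/t)^{3/2} L⁻³) dt`
  — **the `Lℤ³`-periodic, zero-mean Riesz kernel `G_{s,L}` (Ewald / heat-kernel form)**: the
  bracket is the theta function minus its `k = 0` Poisson mode (the uniform background of density
  `L⁻³`), so for `x ∉ Lℤ³` the integral converges absolutely at both ends (`O(t^{-3/2} e^{-c/t})` as
  `t → 0` by Poisson summation, `e^{-t dist(x, Lℤ³)²} + O(t^{-3/2})` as `t → ∞`); with `r₀ = 0` it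
  is `s⁻¹ V_s^{Lℤ³}(x)` in Lewin's notation (Fourier coefficients `∝ |k|^{s-3}` on `(2π/L)ℤ³ ∖ {0}`,
  zero mean), `= |x|⁻ˢ/s +` (smooth) near `0` — Peilen–Serfaty's `g` periodised with background;
  with `r₀ > 0` the singularity `|x - Ln|⁻ˢ/s` is replaced by `max(|x - Ln|, r₀)⁻ˢ/s` (a cap below
  scale `r₀`), giving a bounded kernel. At the lattice points with `r₀ = 0` the integral diverges
  and Lean's Bochner integral returns the junk value `0` (physically `+∞`).
* `rieszHamiltonian s L r₀ X = ∑_{i<j} G_{s,L}^{(r₀)}(xᵢ - xⱼ)` on `Config N` (Peilen–Serfaty's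
  `½ ∑_{i≠j} g`, no confinement, periodic neutralised kernel instead).
* `rieszBoltzmannWeight s L r₀ β w X = exp(-β H(X)) · ∏_{i<j} w(xᵢ - xⱼ)` — the canonical Gibbs
  density, optionally tilted by a pair weight `w` (take `w = 1` for the pure gas; a bounded
  measurable non-negative even `w` of finite range with `w = 0` on a hard core is the intended tilt);
  `rieszPartitionFunction … N = ∫_{cellN N L} weight`, and the Gibbs probability measure
  `rieszGibbsMeasure … N = Z⁻¹ · (Lebesgue on the cell with density weight)` on `Config N`.
* `rieszLandscape s L r₀ X y = ∑ⱼ G(y - xⱼ)` — the potential landscape of the configuration seen at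
  `y` (the background is already inside `G`: this is `h_N` of Peilen–Serfaty (3.3) for the uniform
  background on the torus), `subcube L m k` — the cube `∏ᵢ [kᵢ L/m, (kᵢ + 1) L/m)` of the partition of
  the cell into `m³` cubes — and `rieszLandscapeAvg … X m k = (m/L)³ ∫_{subcube} h_X`.

Proved API: evenness and `Lℤ³`-periodicity of `rieszTheta`, of the kernel and of the landscape
(`…_neg`, `…_add_latticeVec`), non-negativity of the theta sum, unfolding lemmas, the empty and
one-particle Hamiltonians, `subcube` membership. NOT here (analysis, not needed to STATE the crux):
convergence of the `t`-integral, the Fourier expansion, `G = |x|⁻ˢ/s + smooth`, lower bounds on `H`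
(Lewin 2022 Lemma 16), finiteness/positivity of `Z`.

## References

* M. Lewin, *Coulomb and Riesz gases: the known and the unknown*, J. Math. Phys. 63 (2022) 061101,
  arXiv:2202.09240: §1 (`V_s`), §3.1–3.2 (jellium energy with uniform background, Lemma 16),
  §4.1–4.2 (the periodic potential `V_s^Λ`, its Fourier coefficients, Lemmas 31–32) — arXiv
  numbering. [Lewin2022]
* L. Peilen, S. Serfaty, *Local laws and fluctuations for super-Coulombic Riesz gases*,
  arXiv:2511.18623, (1.1)–(1.4) (`P_{N,β}`, `H_N`, `g = |x|⁻ˢ/s`, `d - 2 < s < d`), (3.3) (`h_N`).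
  [PeilenSerfaty2025]
* S. Serfaty, *Lectures on Coulomb and Riesz gases*, arXiv:2407.21194, Ch. 2–3. [Serfaty2024]
* T. Leblé, S. Serfaty, Invent. Math. 210 (2017), §2. [LebleSerfaty2017]
-/

noncomputable section

open MeasureTheory Set
open scoped ENNReal

namespace Literature.MathematicalPhysics.StatisticalMechanics

open Literature.MathematicalPhysics.QuantumManyBody.BoseGas (Space Config cell cellN latticeVec)

/-! ## Lattice vectors (two identities of `PeriodicBoseGasLemma32.lean`, reproved to keep imports light) -/

/-- `n ↦ Ln` is additive (cf. `BoseGas.latticeVec_add` of `PeriodicBoseGasLemma32.lean`). [folklore] -/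
private theorem latticeVec_add' (L : ℝ) (m n : Fin 3 → ℤ) :
    latticeVec L (m + n) = latticeVec L m + latticeVec L n := by
  ext k; simp [latticeVec, mul_add]

/-- `L(-n) = -(Ln)` (cf. `BoseGas.latticeVec_neg`). [folklore] -/
private theorem latticeVec_neg' (L : ℝ) (n : Fin 3 → ℤ) : latticeVec L (-n) = -latticeVec L n := by
  ext k; simp [latticeVec]

/-! ## The lattice theta sum and the neutralised periodic Riesz kernel -/

/-- **Lattice Gaussian sum** `Θ_L^{(r₀)}(t, x) = ∑_{n ∈ ℤ³} exp(-t · max(‖x - L n‖, r₀)²)`: the theta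
function entering the heat-kernel (Ewald) representation of the periodised Riesz kernel, with
distances capped below at the UV length `r₀` (`r₀ ≤ 0`: no cap, since `max(r, r₀) = r`). A `tsum`
(summable for `t > 0`, `L ≠ 0`; junk `0` otherwise). [cite: Lewin2022, §4.1–4.2 (periodic potential via lattice sums)] -/
def rieszTheta (L r₀ t : ℝ) (x : Space) : ℝ :=
  ∑' n : Fin 3 → ℤ, Real.exp (-t * (max ‖x - latticeVec L n‖ r₀) ^ 2)

/-- **The neutralised `Lℤ³`-periodic Riesz kernel** `G_{s,L}^{(r₀)}(x) =
(s Γ(s/2))⁻¹ ∫₀^∞ t^{s/2 - 1} (Θ_L^{(r₀)}(t, x) - (π/t)^{3/2} L⁻³) dt`: lattice sum of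
`max(|x - Ln|, r₀)⁻ˢ/s` MINUS the uniform background of density `L⁻³`, regularised through the heat
kernel (`r⁻ˢ = Γ(s/2)⁻¹ ∫₀^∞ t^{s/2-1} e^{-tr²} dt`; the subtracted `(π/t)^{3/2} L⁻³` is the `k = 0`
Poisson mode of `Θ`). For `r₀ = 0` this is `s⁻¹ V_s^{Lℤ³}` — the zero-mean periodic function with the
Fourier coefficients of `|x|⁻ˢ` (Lewin 2022, §4.2) — i.e. Peilen–Serfaty's `g = |x|⁻ˢ/s` periodised
with background; meaningful for `0 < s < 3` (the super-Coulombic range is `1 < s < 3`), `L > 0`,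
`r₀ ≥ 0`. Junk value `0` where the integral diverges (`x ∈ Lℤ³` with `r₀ = 0`).
[cite: Lewin2022, §4.2 (V_s^Λ) and Lemma 31] -/
def neutralizedRieszKernel (s L r₀ : ℝ) (x : Space) : ℝ :=
  (s * Real.Gamma (s / 2))⁻¹ *
    ∫ t in Ioi (0 : ℝ), t ^ (s / 2 - 1) * (rieszTheta L r₀ t x - (Real.pi / t) ^ (3 / 2 : ℝ) / L ^ 3)

/-- The theta sum is non-negative. [folklore] -/
theorem rieszTheta_nonneg (L r₀ t : ℝ) (x : Space) : 0 ≤ rieszTheta L r₀ t x :=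
  tsum_nonneg fun _ => (Real.exp_pos _).le

/-- The theta sum is even in `x` (reindex `n ↦ -n`). [folklore] -/
theorem rieszTheta_neg (L r₀ t : ℝ) (x : Space) : rieszTheta L r₀ t (-x) = rieszTheta L r₀ t x := by
  unfold rieszTheta
  rw [← (Equiv.neg (Fin 3 → ℤ)).tsum_eq]
  refine tsum_congr fun n => ?_
  rw [Equiv.neg_apply, latticeVec_neg', sub_neg_eq_add, neg_add_eq_sub, norm_sub_rev]

/-- The theta sum is `Lℤ³`-periodic in `x` (reindex `n ↦ n + n₀`). [folklore] -/
theorem rieszTheta_add_latticeVec (L r₀ t : ℝ) (x : Space) (n₀ : Fin 3 → ℤ) :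
    rieszTheta L r₀ t (x + latticeVec L n₀) = rieszTheta L r₀ t x := by
  unfold rieszTheta
  rw [← (Equiv.addRight n₀).tsum_eq]
  refine tsum_congr fun n => ?_
  rw [Equiv.coe_addRight, latticeVec_add', add_sub_add_right_eq_sub]

/-- **`G_{s,L}` is even.** [cite: Lewin2022, §4.2] -/
theorem neutralizedRieszKernel_neg (s L r₀ : ℝ) (x : Space) :
    neutralizedRieszKernel s L r₀ (-x) = neutralizedRieszKernel s L r₀ x := by
  simp only [neutralizedRieszKernel, rieszTheta_neg]

/-- **`G_{s,L}` is `Lℤ³`-periodic.** [cite: Lewin2022, §4.2] -/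
theorem neutralizedRieszKernel_add_latticeVec (s L r₀ : ℝ) (x : Space) (n₀ : Fin 3 → ℤ) :
    neutralizedRieszKernel s L r₀ (x + latticeVec L n₀) = neutralizedRieszKernel s L r₀ x := by
  simp only [neutralizedRieszKernel, rieszTheta_add_latticeVec]

/-- `G(x - y) = G(y - x)`. [folklore] -/
theorem neutralizedRieszKernel_sub_comm (s L r₀ : ℝ) (x y : Space) :
    neutralizedRieszKernel s L r₀ (x - y) = neutralizedRieszKernel s L r₀ (y - x) := by
  rw [← neutralizedRieszKernel_neg, neg_sub]

/-! ## The Hamiltonian, the Gibbs measure -/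

section Gas

variable {N : ℕ}

/-- **The Hamiltonian of the neutralised periodic Riesz gas** `H(X) = ∑_{i<j} G_{s,L}^{(r₀)}(xᵢ - xⱼ)`
of `N` points in the box of side `L` (the particle–background and background–background terms are
inside the zero-mean kernel `G`; Peilen–Serfaty's `½ ∑_{i ≠ j} g(xᵢ - xⱼ)` without confining
potential). [cite: PeilenSerfaty2025, (1.2) (with Lewin2022 §4.2 for the periodic kernel)] -/
def rieszHamiltonian (s L r₀ : ℝ) (X : Config N) : ℝ :=
  ∑ i : Fin N, ∑ j : Fin N with i < j, neutralizedRieszKernel s L r₀ (X i - X j)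

/-- No pairs, no energy: `H = 0` for `N ≤ 1`. [folklore] -/
theorem rieszHamiltonian_of_subsingleton [Subsingleton (Fin N)] (s L r₀ : ℝ) (X : Config N) :
    rieszHamiltonian s L r₀ X = 0 := by
  refine Finset.sum_eq_zero fun i _ => Finset.sum_eq_zero fun j hj => ?_
  exact absurd (Finset.mem_filter.1 hj).2 (by rw [Subsingleton.elim i j]; exact lt_irrefl _)

/-- **The (tilted) Boltzmann weight** `exp(-β H(X)) · ∏_{i<j} w(xᵢ - xⱼ)`: canonical Gibbs density
of the Riesz gas at inverse temperature `β`, multiplied by an optional pair weight `w` (`w = 1`: the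
pure gas, `rieszBoltzmannWeight_one`; a bounded non-negative even finite-range `w` vanishing on a
hard core is the intended perturbation). Here `β` multiplies `H` directly (thermodynamic convention at
fixed density, as in Lewin 2022 §3.2); Peilen–Serfaty's mean-field normalisation `e^{-β N^{-s/d} H_N}`
of (1.1) is the case `β ↦ β N^{-s/3}`. [cite: PeilenSerfaty2025, (1.1)] -/
def rieszBoltzmannWeight (s L r₀ β : ℝ) (w : Space → ℝ) (X : Config N) : ℝ :=
  Real.exp (-β * rieszHamiltonian s L r₀ X) * ∏ i : Fin N, ∏ j : Fin N with i < j, w (X i - X j)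

/-- Without tilt the weight is the Boltzmann factor `exp(-β H)`. [cite: PeilenSerfaty2025, (1.1)] -/
theorem rieszBoltzmannWeight_one (s L r₀ β : ℝ) (X : Config N) :
    rieszBoltzmannWeight s L r₀ β 1 X = Real.exp (-β * rieszHamiltonian s L r₀ X) := by
  simp [rieszBoltzmannWeight]

/-- The untilted weight is positive. [folklore] -/
theorem rieszBoltzmannWeight_one_pos (s L r₀ β : ℝ) (X : Config N) :
    0 < rieszBoltzmannWeight s L r₀ β 1 X := by
  rw [rieszBoltzmannWeight_one]; exact Real.exp_pos _

/-- The weight is non-negative for a non-negative tilt. [folklore] -/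
theorem rieszBoltzmannWeight_nonneg (s L r₀ β : ℝ) {w : Space → ℝ} (hw : ∀ x, 0 ≤ w x)
    (X : Config N) : 0 ≤ rieszBoltzmannWeight s L r₀ β w X :=
  mul_nonneg (Real.exp_pos _).le
    (Finset.prod_nonneg fun _ _ => Finset.prod_nonneg fun _ _ => hw _)

variable (N) in
/-- **The canonical partition function** `Z = ∫_{([0,L)³)^N} exp(-β H(X)) ∏_{i<j} w(xᵢ - xⱼ) dX`
(Lebesgue measure on `Config N = (ℝ³)^N` restricted to the fundamental cell; junk `0` if the weight is
not integrable). [cite: PeilenSerfaty2025, (1.4)] -/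
def rieszPartitionFunction (s L r₀ β : ℝ) (w : Space → ℝ) : ℝ :=
  ∫ X in cellN N L, rieszBoltzmannWeight s L r₀ β w X

variable (N) in
/-- **The canonical Gibbs measure** of the neutralised periodic Riesz gas of `N` points in the box
`[0, L)³` at inverse temperature `β` (tilted by `w`): the measure on `Config N` with density
`Z⁻¹ exp(-β H) ∏ w` with respect to Lebesgue measure on the cell `cellN N L` (a probability
measure when `0 < Z < ∞`; with `Z = 0` or `∞` Lean's conventions give a junk measure).
[cite: PeilenSerfaty2025, (1.1)] -/
def rieszGibbsMeasure (s L r₀ β : ℝ) (w : Space → ℝ) : Measure (Config N) :=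
  (ENNReal.ofReal (rieszPartitionFunction N s L r₀ β w))⁻¹ •
    (volume.restrict (cellN N L)).withDensity fun X => ENNReal.ofReal (rieszBoltzmannWeight s L r₀ β w X)

/-- Unfolding the Gibbs measure on a set: `μ(A) = Z⁻¹ ∫_{A ∩ cell} exp(-βH) ∏ w`. [folklore] -/
theorem rieszGibbsMeasure_apply (s L r₀ β : ℝ) (w : Space → ℝ) {A : Set (Config N)}
    (hA : MeasurableSet A) :
    rieszGibbsMeasure N s L r₀ β w A =
      (ENNReal.ofReal (rieszPartitionFunction N s L r₀ β w))⁻¹ *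
        ∫⁻ X in A, ENNReal.ofReal (rieszBoltzmannWeight s L r₀ β w X) ∂(volume.restrict (cellN N L)) := by
  rw [rieszGibbsMeasure, Measure.smul_apply, withDensity_apply _ hA, smul_eq_mul]

/-! ## The potential landscape and its coarse-graining -/

/-- **The potential landscape** `h_X(y) = ∑ⱼ G_{s,L}^{(r₀)}(y - xⱼ)` of the configuration `X` seen
at the point `y` (the neutralising background is inside `G`, so this is Peilen–Serfaty's
`h_N = g ∗ (∑ᵢ δ_{xᵢ} - N μ)` for the uniform background `μ = L⁻³ 𝟙` on the torus).
[cite: PeilenSerfaty2025, (3.3)] -/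
def rieszLandscape (s L r₀ : ℝ) (X : Config N) (y : Space) : ℝ :=
  ∑ j : Fin N, neutralizedRieszKernel s L r₀ (y - X j)

/-- The landscape is `Lℤ³`-periodic in the observation point. [folklore] -/
theorem rieszLandscape_add_latticeVec (s L r₀ : ℝ) (X : Config N) (y : Space) (n₀ : Fin 3 → ℤ) :
    rieszLandscape s L r₀ X (y + latticeVec L n₀) = rieszLandscape s L r₀ X y := by
  unfold rieszLandscape
  refine Finset.sum_congr rfl fun j _ => ?_
  rw [add_sub_right_comm, neutralizedRieszKernel_add_latticeVec]

/-- `H(X) = ½ ∑ᵢ (h_X(xᵢ) - G(0))`-type bookkeeping is not needed; we only record that the landscape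
of the empty configuration vanishes. [folklore] -/
theorem rieszLandscape_of_isEmpty [IsEmpty (Fin N)] (s L r₀ : ℝ) (X : Config N) (y : Space) :
    rieszLandscape s L r₀ X y = 0 := by
  simp [rieszLandscape]

/-- The sub-cube `Q_k = ∏ᵢ [kᵢ L/m, (kᵢ + 1) L/m)` of side `L/m` (`k ∈ ℤ³`; the `m³` cubes with
`0 ≤ kᵢ < m` partition the cell `[0, L)³`). [folklore] -/
def subcube (L : ℝ) (m : ℕ) (k : Fin 3 → ℤ) : Set Space :=
  {y | ∀ i, y i ∈ Ico ((k i : ℝ) * L / m) (((k i : ℝ) + 1) * L / m)}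

/-- Membership in a sub-cube, unfolded. [folklore] -/
theorem mem_subcube_iff {L : ℝ} {m : ℕ} {k : Fin 3 → ℤ} {y : Space} :
    y ∈ subcube L m k ↔ ∀ i, (k i : ℝ) * L / m ≤ y i ∧ y i < ((k i : ℝ) + 1) * L / m :=
  Iff.rfl

/-- With `m = 1` and `k = 0` the sub-cube is the whole cell `[0, L)³`. [folklore] -/
theorem subcube_one_zero (L : ℝ) : subcube L 1 0 = cell L := by
  ext y
  simp [subcube, cell, Set.mem_Ico]

/-- **Coarse-grained landscape**: the average `(m/L)³ ∫_{Q_k} h_X(y) dy` of the landscape over the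
sub-cube `Q_k` of side `L/m`. [cite: PeilenSerfaty2025, (3.3) (coarse-grained as in Thm. 1)] -/
def rieszLandscapeAvg (s L r₀ : ℝ) (X : Config N) (m : ℕ) (k : Fin 3 → ℤ) : ℝ :=
  ((m : ℝ) / L) ^ 3 * ∫ y in subcube L m k, rieszLandscape s L r₀ X y

/-- Unfolding `rieszLandscapeAvg`. [folklore] -/
theorem rieszLandscapeAvg_eq (s L r₀ : ℝ) (X : Config N) (m : ℕ) (k : Fin 3 → ℤ) :
    rieszLandscapeAvg s L r₀ X m k =
      ((m : ℝ) / L) ^ 3 * ∫ y in subcube L m k, ∑ j : Fin N, neutralizedRieszKernel s L r₀ (y - X j) :=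
  rfl

end Gas

end Literature.MathematicalPhysics.StatisticalMechanics

end
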